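import Literature.NumberTheory.Automorphic.ChevalleyGroupAdjoint
import HarnessLib

/-!
# Transport of `Ad (exp N) = exp (ad N)` under maps intertwining `ad N` and `ad N'`
(trunk T-AUTOMORPHIC, G25 AutomorphicL; characteristic-`0` tool for the graph proof of
`chevalley_isomorphism_abstract` / `chevalley_isomorphism`, Springer 9.6.2)

A thin sibling of `ChevalleyGroupAdjoint.lean`, which already provides the adjoint exponential
calculus on `𝔤𝔩_n` (`adOp N = L_N - R_N`, `isNilpotent_adOp`, `exp_mul_mul_exp_neg_eq`:
`exp(N) A exp(-N) = exp (ad N) (A)`, `exp_mul_mul_exp_neg_mem`). Added here: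

* `map_adOp_pow_of_forall_map_lie` — if a linear map `ψ` on a subspace `𝔤 ⊆ 𝔤𝔩_n` stable under
  `ad N` satisfies `ψ [N, A] = [N', ψ A]` (`A ∈ 𝔤`), then `ψ ((ad N)^m A) = (ad N')^m (ψ A)`;
* **`map_conj_exp_of_forall_map_lie`** — hence, for `N`, `N'` nilpotent,
  `ψ (exp(N) A exp(-N)) = exp(N') ψ(A) exp(-N')`: a Lie-algebra homomorphism intertwines the adjoint
  actions of the one-parameter unipotent groups `exp(x N)`, `exp(x N')` (Humphreys, *Linear Algebraic
  Groups*, 15.1; Springer 4.4.15–4.4.16 in characteristic `0`).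

Everything is proved; [folklore]. (Library fit: the general identity `Ad (exp N) = exp (ad N)` is
`exp_mul_mul_exp_neg_eq` of `ChevalleyGroupAdjoint.lean`, found by `lean search 'exp .* \* .* \* .*exp \(-'`;
nothing of it is restated here.)

## References

* J. E. Humphreys, *Linear Algebraic Groups*, GTM 21, Springer (1975), §15.1.
* [SpringerLAG1998] T. A. Springer, *Linear Algebraic Groups*, 2nd ed. (1998), 4.4.15–4.4.16.
-/

noncomputable section

open scoped MatrixGroups

namespace Literature.NumberTheory.Automorphic

variable {k : Type*} [Field k] {n : Type*} [Fintype n] [DecidableEq n]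
variable {n' : Type*} [Fintype n'] [DecidableEq n']

/-- Iterates: `ψ ((ad N)^m A) = (ad N')^m (ψ A)` when `ψ` intertwines `ad N` on `𝔤` with `ad N'`.
[folklore] -/
lemma map_adOp_pow_of_forall_map_lie
    {L : Submodule k (Matrix n n k)} (ψ : ↥L →ₗ[k] Matrix n' n' k) {N : Matrix n n k} {N' : Matrix n' n' k}
    (hNL : ∀ A ∈ L, N * A - A * N ∈ L)
    (hψ : ∀ A : ↥L, ψ ⟨N * A - A * N, hNL A A.2⟩ = N' * ψ A - ψ A * N') (m : ℕ) (A : ↥L) :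
    ∃ hm : (adOp N ^ m) (A : Matrix n n k) ∈ L,
      ψ ⟨(adOp N ^ m) (A : Matrix n n k), hm⟩ = (adOp N' ^ m) (ψ A) := by
  induction m with
  | zero => exact ⟨by simp, by simp⟩
  | succ m ih =>
    obtain ⟨hm, e⟩ := ih
    have hm1 : (adOp N ^ (m + 1)) (A : Matrix n n k) =
        N * (adOp N ^ m) (A : Matrix n n k) - (adOp N ^ m) (A : Matrix n n k) * N := by
      rw [pow_succ', Module.End.mul_apply, adOp_apply]
    have hmem1 : (adOp N ^ (m + 1)) (A : Matrix n n k) ∈ L := by rw [hm1]; exact hNL _ hm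
    refine ⟨hmem1, ?_⟩
    have h2 := hψ ⟨(adOp N ^ m) (A : Matrix n n k), hm⟩
    rw [e] at h2
    have lhs : (⟨(adOp N ^ (m + 1)) (A : Matrix n n k), hmem1⟩ : ↥L) =
        ⟨N * (adOp N ^ m) (A : Matrix n n k) - (adOp N ^ m) (A : Matrix n n k) * N, hNL _ hm⟩ :=
      Subtype.ext hm1
    rw [lhs, h2, pow_succ', Module.End.mul_apply, adOp_apply]

variable [CharZero k]

/-- **Transport of `Ad (exp N)` under a map intertwining `ad N` and `ad N'`**: if `ψ : 𝔤 → 𝔤𝔩_{n'}`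
is linear on a subspace `𝔤 ⊆ 𝔤𝔩_n` stable under `ad N` and `ψ [N, A] = [N', ψ A]` for `A ∈ 𝔤`, with
`N`, `N'` nilpotent, then `ψ (exp(N) A exp(-N)) = exp(N') ψ(A) exp(-N')` (the membership
`exp(N) A exp(-N) ∈ 𝔤` being `exp_mul_mul_exp_neg_mem`). [cite: SpringerLAG1998, 4.4.15] -/
theorem map_conj_exp_of_forall_map_lie
    {L : Submodule k (Matrix n n k)} (ψ : ↥L →ₗ[k] Matrix n' n' k) {N : Matrix n n k} {N' : Matrix n' n' k}
    (hN : IsNilpotent N) (hN' : IsNilpotent N')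
    (hNL : ∀ A ∈ L, N * A - A * N ∈ L)
    (hψ : ∀ A : ↥L, ψ ⟨N * A - A * N, hNL A A.2⟩ = N' * ψ A - ψ A * N') (A : ↥L) :
    ψ ⟨IsNilpotent.exp N * (A : Matrix n n k) * IsNilpotent.exp (-N), exp_mul_mul_exp_neg_mem hN hNL A.2⟩ =
      IsNilpotent.exp N' * ψ A * IsNilpotent.exp (-N') := by
  obtain ⟨K₁, hK₁⟩ := isNilpotent_adOp hN
  obtain ⟨K₂, hK₂⟩ := isNilpotent_adOp hN'
  have h₁ : adOp N ^ (K₁ + K₂) = 0 := pow_eq_zero_of_le (Nat.le_add_right _ _) hK₁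
  have h₂ : adOp N' ^ (K₁ + K₂) = 0 := pow_eq_zero_of_le (Nat.le_add_left _ _) hK₂
  rw [exp_mul_mul_exp_neg_eq hN']
  have e1 : IsNilpotent.exp N * (A : Matrix n n k) * IsNilpotent.exp (-N) = IsNilpotent.exp (adOp N) A :=
    exp_mul_mul_exp_neg_eq hN A
  rw [IsNilpotent.exp_eq_sum h₂, IsNilpotent.exp_eq_sum h₁] at *
  simp only [LinearMap.coe_sum, Finset.sum_apply, LinearMap.smul_apply] at e1 ⊢
  -- rewrite the argument of `ψ` as a sum of elements of `L` and use linearity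
  have hterm : ∀ m : ℕ, ∃ hm : (adOp N ^ m) (A : Matrix n n k) ∈ L,
      ψ ⟨(adOp N ^ m) (A : Matrix n n k), hm⟩ = (adOp N' ^ m) (ψ A) :=
    fun m => map_adOp_pow_of_forall_map_lie ψ hNL hψ m A
  choose hm hψm using hterm
  have hsum : (⟨IsNilpotent.exp N * (A : Matrix n n k) * IsNilpotent.exp (-N), exp_mul_mul_exp_neg_mem hN hNL A.2⟩ : ↥L) =
      ∑ m ∈ Finset.range (K₁ + K₂), ((m.factorial : ℚ)⁻¹ • (⟨(adOp N ^ m) (A : Matrix n n k), hm m⟩ : ↥L)) := by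
    apply Subtype.ext
    simp only [Submodule.coe_sum, Submodule.coe_smul_of_tower]
    exact e1
  rw [hsum, map_sum]
  refine Finset.sum_congr rfl fun m _ => ?_
  rw [LinearMap.map_smul_of_tower, hψm]

end Literature.NumberTheory.Automorphic
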